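import Mathlib
import HarnessLib
import Summits.HubbardSuperconductivity.HubbardSuperconductivity.Theorems.KLProgrammeKLRegimeSplitBundleV15
import Summits.HubbardSuperconductivity.HubbardSuperconductivity.Theorems.KLProgrammeKLRegimeSplitGeoRaise

/-!
# Raising the TWO-LEG size constants `S j` and `SL` of a geometric package `G` — the transfer toolkit for a possible gen-6 package step
# `klEngGeo5 ↦ klEngGeo6 := klEngGeo5.raiseTwoLeg s sl` (plan g14 (R17) PACKAGE-AT-REGISTRATION, STANDBY; cell gate-hubbard-kl, seat hubbard-kl-k3c2-p2 g6)

Planner ruling (R17) (STATUS 2026-08-27 06:26Z): the gen-6 engine skeleton is registered once with the least already-typed package against which every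
by-name closer AND k3c3-p3's MS-A34 discharge inequality hold; if `(G5, Q5)` is «SHORT», the two-leg size constants `S`, `SL` (and `Q.CE`) are
raised «through monotone doors exactly like G4/G5».  This file is the `G`-side door, for ANY `G`, `s : ℕ → ℝ`, `sl : ℝ`:

* §1 **`GeoConsts.raiseTwoLeg G s sl := { G with S := fun j => max (G.S j) (s j), SL := max G.SL sl }`**, `rfl` lemmas for every untouched field,
  the four inequalities `G.S j ≤ _`, `s j ≤ _`, `G.SL ≤ _`, `sl ≤ _`, **`GeoConsts.raiseTwoLeg_wf : G.WF → (G.raiseTwoLeg s sl).WF`**;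
* §2 the ENGINE-slot majorants are literally unchanged (`initDevBar`, `legDressBarQ`, `legDressBarQ2`, `gainBar`, `eremBar`, `thermalBar`, `driveBar`,
  `drivePBar`, `klEdge`, `Bcum`, `Ecum`, `EcumP`, `abot0`, `atop0`, `bflBar`: `… (G.raiseTwoLeg s sl) … = … G …`), and the TWO-LEG majorants are
  MONOTONE: `twoLegBar G ≤ twoLegBar (G.raiseTwoLeg s sl)`, `lipBar G ≤ lipBar (G.raiseTwoLeg …)`, `msBarQ G ≤ msBarQ (G.raiseTwoLeg …)` (`0 ≤ Q.CE`);
* §3 predicate level: the V10 ENGINE slot, `BetaSplitAtS2` and the comparison history `histV15` are INVARIANT (`iff`), and the two-leg OUTPUT clauses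
  transfer covariantly at a fixed history: `TwoLegSizesT1Fn`, `FrameLipschitzFnTD hist`, `TwoLegSizesMSFnQ`/`MSTQ` (`Q.WF`, `R.WF`), `TwoLegCoreTD hist`;
  hence `twoLegCoreTD_histV15_raiseTwoLeg_of` (the step's first conjunct) and `twoLegSizesMSTQ_raiseTwoLeg_of` (its second).

NOT covered (not true by monotonicity, as for `GeoConsts.raise`): the third conjunct `TwoLegVolumeRateA …` of `TwoLegStepV15`, whose ANTECEDENT reads
`TwoLegCoreTD`/`TwoLegSizesMSTQ` at the package (a larger package weakens the antecedent), and the history `HistP klPredsV15 … G …` in hypothesis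
position of the step stubs — closers must be `G`-parametric there.  Definitions with bodies + order lemmas; nothing about the model is asserted.
-/

namespace Summit.HubbardSuperconductivity.HubbardSuperconductivity.Theorems.KLRegimeSplit

noncomputable section

set_option linter.dupNamespace false -- summit = problem name (single-conjunct summit), D-0017

open Real Finset Literature.MathematicalPhysics.QuantumLattice Literature.Probability.LatticeModels
open Summit.HubbardSuperconductivity.HubbardSuperconductivity.Theorems.KLProgrammeLegKernels

/-! ## §1 The raised package -/

/-- **`G.raiseTwoLeg s sl`** — the geometric package `G` with `S := fun j => max (G.S j) (s j)` and `SL := max G.SL sl`, every other field untouched. -/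
def GeoConsts.raiseTwoLeg (G : GeoConsts) (s : ℕ → ℝ) (sl : ℝ) : GeoConsts :=
  { G with S := fun j => max (G.S j) (s j), SL := max G.SL sl }

namespace GeoConsts

variable (G : GeoConsts) (s : ℕ → ℝ) (sl : ℝ)

/-- `(G.raiseTwoLeg s sl).S j = max (G.S j) (s j)`. -/
theorem raiseTwoLeg_S (j : ℕ) : (G.raiseTwoLeg s sl).S j = max (G.S j) (s j) := rfl
/-- `(G.raiseTwoLeg s sl).SL = max G.SL sl`. -/
theorem raiseTwoLeg_SL : (G.raiseTwoLeg s sl).SL = max G.SL sl := rfl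
/-- untouched field `atop`. -/
theorem raiseTwoLeg_atop : (G.raiseTwoLeg s sl).atop = G.atop := rfl
/-- untouched field `abot`. -/
theorem raiseTwoLeg_abot : (G.raiseTwoLeg s sl).abot = G.abot := rfl
/-- untouched field `blo`. -/
theorem raiseTwoLeg_blo : (G.raiseTwoLeg s sl).blo = G.blo := rfl
/-- untouched field `bhi`. -/
theorem raiseTwoLeg_bhi : (G.raiseTwoLeg s sl).bhi = G.bhi := rfl
/-- untouched field `cloc`. -/
theorem raiseTwoLeg_cloc : (G.raiseTwoLeg s sl).cloc = G.cloc := rfl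
/-- untouched field `θ`. -/
theorem raiseTwoLeg_θ : (G.raiseTwoLeg s sl).θ = G.θ := rfl
/-- untouched field `a`. -/
theorem raiseTwoLeg_a : (G.raiseTwoLeg s sl).a = G.a := rfl
/-- untouched field `ζ`. -/
theorem raiseTwoLeg_ζ : (G.raiseTwoLeg s sl).ζ = G.ζ := rfl
/-- untouched field `Z`. -/
theorem raiseTwoLeg_Z : (G.raiseTwoLeg s sl).Z = G.Z := rfl
/-- untouched field `aplus`. -/
theorem raiseTwoLeg_aplus : (G.raiseTwoLeg s sl).aplus = G.aplus := rfl
/-- untouched field `ppGain`. -/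
theorem raiseTwoLeg_ppGain : (G.raiseTwoLeg s sl).ppGain = G.ppGain := rfl
/-- untouched field `phGain`. -/
theorem raiseTwoLeg_phGain : (G.raiseTwoLeg s sl).phGain = G.phGain := rfl
/-- untouched field `CF`. -/
theorem raiseTwoLeg_CF : (G.raiseTwoLeg s sl).CF = G.CF := rfl
/-- untouched field `cE4`. -/
theorem raiseTwoLeg_cE4 : (G.raiseTwoLeg s sl).cE4 = G.cE4 := rfl
/-- untouched field `Bf`. -/
theorem raiseTwoLeg_Bf : (G.raiseTwoLeg s sl).Bf = G.Bf := rfl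

/-- `G.S j ≤ (G.raiseTwoLeg s sl).S j`. -/
theorem S_le_raiseTwoLeg_S (j : ℕ) : G.S j ≤ (G.raiseTwoLeg s sl).S j := le_max_left _ _
/-- `s j ≤ (G.raiseTwoLeg s sl).S j`. -/
theorem le_raiseTwoLeg_S (j : ℕ) : s j ≤ (G.raiseTwoLeg s sl).S j := le_max_right _ _
/-- `G.SL ≤ (G.raiseTwoLeg s sl).SL`. -/
theorem SL_le_raiseTwoLeg_SL : G.SL ≤ (G.raiseTwoLeg s sl).SL := le_max_left _ _
/-- `sl ≤ (G.raiseTwoLeg s sl).SL`. -/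
theorem le_raiseTwoLeg_SL : sl ≤ (G.raiseTwoLeg s sl).SL := le_max_right _ _

variable {G}

/-- **Raising `S`, `SL` preserves well-formedness** (they enter `GeoConsts.WF` only through `0 ≤ S j`, `0 ≤ SL`). -/
theorem raiseTwoLeg_wf (hG : G.WF) (s : ℕ → ℝ) (sl : ℝ) : (G.raiseTwoLeg s sl).WF := by
  obtain ⟨h1, h2, h3, h4, h5, h6, h7, h8, h9, h10, h11, h12, h13, h14, h15, h16, h17, h18, h19, h20⟩ := hG
  exact ⟨h1, h2, h3, h4, h5, h6, h7, h8, h9, h10, h11, h12, h13, h14, h15, h16, h17, fun j => le_max_of_le_left (h18 j), h19,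
    le_max_of_le_left h20⟩

end GeoConsts

/-! ## §2 The majorants under `raiseTwoLeg` -/

section Bars

variable (G : GeoConsts) (s : ℕ → ℝ) (sl : ℝ) (P : SplitConsts) (Q : EngConsts)

/-- `initDevBar` unchanged. -/
theorem initDevBar_raiseTwoLeg (U : ℝ) : initDevBar (G.raiseTwoLeg s sl) U = initDevBar G U := rfl
/-- `legDressBarQ` unchanged. -/
theorem legDressBarQ_raiseTwoLeg (U : ℝ) (n c : ℕ) : legDressBarQ (G.raiseTwoLeg s sl) P Q U n c = legDressBarQ G P Q U n c := rfl
/-- `legDressBarQ2` unchanged. -/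
theorem legDressBarQ2_raiseTwoLeg (U : ℝ) (n c : ℕ) : legDressBarQ2 (G.raiseTwoLeg s sl) P Q U n c = legDressBarQ2 G P Q U n c := rfl
/-- `gainBar` unchanged. -/
theorem gainBar_raiseTwoLeg (U : ℝ) (n : ℕ) (ρpp ρd ρx : ℝ) :
    gainBar (G.raiseTwoLeg s sl) P U n ρpp ρd ρx = gainBar G P U n ρpp ρd ρx := rfl
/-- `eremBar` unchanged. -/
theorem eremBar_raiseTwoLeg (U β : ℝ) (L n : ℕ) : eremBar (G.raiseTwoLeg s sl) P Q U β L n = eremBar G P Q U β L n := rfl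
/-- `thermalBar` unchanged. -/
theorem thermalBar_raiseTwoLeg (U β : ℝ) (n : ℕ) : thermalBar (G.raiseTwoLeg s sl) P U β n = thermalBar G P U β n := rfl
/-- `driveBar` unchanged. -/
theorem driveBar_raiseTwoLeg (U : ℝ) (χ : D4Irrep) (n : ℕ) : driveBar (G.raiseTwoLeg s sl) U χ n = driveBar G U χ n := rfl
/-- `drivePBar` unchanged. -/
theorem drivePBar_raiseTwoLeg (U : ℝ) (n : ℕ) : drivePBar (G.raiseTwoLeg s sl) P U n = drivePBar G P U n := rfl
/-- `klEdge` unchanged. -/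
theorem klEdge_raiseTwoLeg (n : ℕ) (ρ : ℝ) : klEdge (G.raiseTwoLeg s sl) n ρ = klEdge G n ρ := rfl
/-- `Bcum` unchanged. -/
theorem Bcum_raiseTwoLeg (n : ℕ) : Bcum (G.raiseTwoLeg s sl) n = Bcum G n := rfl
/-- `Ecum` unchanged. -/
theorem Ecum_raiseTwoLeg (U β : ℝ) (L : ℕ) (χ : D4Irrep) (n : ℕ) : Ecum (G.raiseTwoLeg s sl) P Q U β L χ n = Ecum G P Q U β L χ n := rfl
/-- `EcumP` unchanged. -/
theorem EcumP_raiseTwoLeg (U β : ℝ) (L n : ℕ) : EcumP (G.raiseTwoLeg s sl) P Q U β L n = EcumP G P Q U β L n := rfl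
/-- `abot0` unchanged. -/
theorem abot0_raiseTwoLeg (U : ℝ) (χ : D4Irrep) : abot0 (G.raiseTwoLeg s sl) U χ = abot0 G U χ := rfl
/-- `atop0` unchanged. -/
theorem atop0_raiseTwoLeg (U : ℝ) (χ : D4Irrep) : atop0 (G.raiseTwoLeg s sl) U χ = atop0 G U χ := rfl
/-- `bflBar` unchanged (reads `Bf`, `θ`). -/
theorem bflBar_raiseTwoLeg (U : ℝ) (n : ℕ) : bflBar (G.raiseTwoLeg s sl) Q U n = bflBar G Q U n := rfl

variable {G Q}

/-- **`twoLegBar` grows** under `raiseTwoLeg`. -/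
theorem twoLegBar_le_raiseTwoLeg (U : ℝ) (j n : ℕ) :
    twoLegBar G Q U j n ≤ twoLegBar (G.raiseTwoLeg s sl) Q U j n := by
  unfold twoLegBar
  have h1 : G.S j + Q.S' j * |U| ≤ (G.raiseTwoLeg s sl).S j + Q.S' j * |U| := by
    linarith [GeoConsts.S_le_raiseTwoLeg_S G s sl j]
  have h2 : 0 ≤ uPow j U * (4 : ℝ) ^ (((j : ℤ) - 2) * n) := mul_nonneg (uPow_nonneg j U) (zpow_nonneg (by norm_num) _)
  calc (G.S j + Q.S' j * |U|) * uPow j U * (4 : ℝ) ^ (((j : ℤ) - 2) * n)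
      = (G.S j + Q.S' j * |U|) * (uPow j U * (4 : ℝ) ^ (((j : ℤ) - 2) * n)) := by ring
    _ ≤ ((G.raiseTwoLeg s sl).S j + Q.S' j * |U|) * (uPow j U * (4 : ℝ) ^ (((j : ℤ) - 2) * n)) :=
        mul_le_mul_of_nonneg_right h1 h2
    _ = ((G.raiseTwoLeg s sl).S j + Q.S' j * |U|) * uPow j U * (4 : ℝ) ^ (((j : ℤ) - 2) * n) := by ring

/-- **`lipBar` grows** under `raiseTwoLeg`. -/
theorem lipBar_le_raiseTwoLeg (U : ℝ) (n : ℕ) : lipBar G Q U n ≤ lipBar (G.raiseTwoLeg s sl) Q U n := by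
  unfold lipBar
  have h1 : G.SL + Q.SL * |U| ≤ (G.raiseTwoLeg s sl).SL + Q.SL * |U| := by
    linarith [GeoConsts.SL_le_raiseTwoLeg_SL G s sl]
  have h2 : 0 ≤ |U| * ((4 : ℝ) ^ n)⁻¹ := by positivity
  calc (G.SL + Q.SL * |U|) * |U| * ((4 : ℝ) ^ n)⁻¹ = (G.SL + Q.SL * |U|) * (|U| * ((4 : ℝ) ^ n)⁻¹) := by ring
    _ ≤ ((G.raiseTwoLeg s sl).SL + Q.SL * |U|) * (|U| * ((4 : ℝ) ^ n)⁻¹) := mul_le_mul_of_nonneg_right h1 h2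
    _ = ((G.raiseTwoLeg s sl).SL + Q.SL * |U|) * |U| * ((4 : ℝ) ^ n)⁻¹ := by ring

/-- **`msBarQ` grows** under `raiseTwoLeg` (`0 ≤ Q.CE`). -/
theorem msBarQ_le_raiseTwoLeg (hCE : 0 ≤ Q.CE) (U : ℝ) (n : ℕ) :
    msBarQ G Q U n ≤ msBarQ (G.raiseTwoLeg s sl) Q U n := by
  unfold msBarQ
  exact mul_le_mul_of_nonneg_left (twoLegBar_le_raiseTwoLeg s sl U 1 n) hCE

end Bars

/-! ## §3 Predicate level -/

section Model

variable {L M : ℕ} [NeZero L] [NeZero M] {G : GeoConsts} {s : ℕ → ℝ} {sl : ℝ} {P : SplitConsts} {Q : EngConsts} {R : RenConsts}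
  {β U μ : ℝ} {K : TrigPolyC4v} {n : ℕ}

/-- **The V10 engine slot does not read `S`, `SL`**: `EngineBoundsAtV10S … (G.raiseTwoLeg s sl) … ↔ EngineBoundsAtV10S … G …`. -/
theorem engineBoundsAtV10S_raiseTwoLeg_iff (s : ℕ → ℝ) (sl : ℝ) :
    EngineBoundsAtV10S L M (G.raiseTwoLeg s sl) P Q β U μ K n ↔ EngineBoundsAtV10S L M G P Q β U μ K n := Iff.rfl

/-- The V9 engine slot likewise. -/
theorem engineBoundsAtV9S_raiseTwoLeg_iff (s : ℕ → ℝ) (sl : ℝ) :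
    EngineBoundsAtV9S L M (G.raiseTwoLeg s sl) P Q β U μ K n ↔ EngineBoundsAtV9S L M G P Q β U μ K n := Iff.rfl

/-- `BetaSplitAtS2` does not read `G` at all. -/
theorem betaSplitAtS2_raiseTwoLeg_iff (s : ℕ → ℝ) (sl : ℝ) :
    BetaSplitAtS2 L M (G.raiseTwoLeg s sl) P Q β U μ K n ↔ BetaSplitAtS2 L M G P Q β U μ K n := Iff.rfl

/-- **The comparison history `histV15` is invariant** under `raiseTwoLeg` (it reads `G` only through the engine slot and `BetaSplitAtS2`). -/
theorem histV15_raiseTwoLeg_iff (s : ℕ → ℝ) (sl : ℝ) (K' : TrigPolyC4v) (j : ℕ) :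
    histV15 L M (G.raiseTwoLeg s sl) P Q R β U μ K' j ↔ histV15 L M G P Q R β U μ K' j := Iff.rfl

/-- As functions: `histV15 … (G.raiseTwoLeg s sl) … = histV15 … G …`. -/
theorem histV15_raiseTwoLeg_eq (s : ℕ → ℝ) (sl : ℝ) :
    histV15 L M (G.raiseTwoLeg s sl) P Q R β U μ = histV15 L M G P Q R β U μ := rfl

/-- **(E3a-T1) transfers covariantly**: `TwoLegSizesT1Fn … G … → TwoLegSizesT1Fn … (G.raiseTwoLeg s sl) …`. -/
theorem twoLegSizesT1Fn_raiseTwoLeg_of {f : FrameFn} (h : TwoLegSizesT1Fn L M G Q β U μ f n) :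
    TwoLegSizesT1Fn L M (G.raiseTwoLeg s sl) Q β U μ f n :=
  ⟨h.1, fun j hj q => (h.2 j hj q).trans (twoLegBar_le_raiseTwoLeg s sl U j n)⟩

/-- **(E3c-TD) transfers covariantly at a fixed history**: `FrameLipschitzFnTD hist G … → FrameLipschitzFnTD hist (G.raiseTwoLeg s sl) …`. -/
theorem frameLipschitzFnTD_raiseTwoLeg_of {hist : TrigPolyC4v → ℕ → Prop} (h : FrameLipschitzFnTD L M hist G Q R β U μ K n) :
    FrameLipschitzFnTD L M hist (G.raiseTwoLeg s sl) Q R β U μ K n := by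
  intro K' hK' hh q
  refine (h K' hK' hh q).trans ?_
  exact mul_le_mul_of_nonneg_right (lipBar_le_raiseTwoLeg s sl U n) (frameDist_nonneg K K')

/-- **(E3a-MS-FnQ) transfers covariantly** (`Q.WF`, `R.WF`). -/
theorem twoLegSizesMSFnQ_raiseTwoLeg_of (hQ : Q.WF) (hR : R.WF) {f : FrameFn} (h : TwoLegSizesMSFnQ L M G Q R β U μ f n) :
    TwoLegSizesMSFnQ L M (G.raiseTwoLeg s sl) Q R β U μ f n := by
  obtain ⟨lp, h1, h2, h3, h4⟩ := h
  refine ⟨lp, h1, h2, fun j hj q => (h3 j hj q).trans (twoLegBar_le_raiseTwoLeg s sl U j n), fun m hm j hj q => ?_⟩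
  refine (h4 m hm j hj q).trans ?_
  have hb : 0 ≤ R.Gfr j * uPow j U * (4 : ℝ) ^ (((j : ℤ) - 2) * m) :=
    mul_nonneg (mul_nonneg (hR.2.2 j) (uPow_nonneg j U)) (zpow_nonneg (by norm_num) _)
  exact mul_le_mul_of_nonneg_right (msBarQ_le_raiseTwoLeg s sl hQ.1 U n) hb

/-- (E3a-MS-TQ) transfers covariantly (`Q.WF`, `R.WF`). -/
theorem twoLegSizesMSTQ_raiseTwoLeg_of (hQ : Q.WF) (hR : R.WF) (h : TwoLegSizesMSTQ L M G Q R β U μ K n) :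
    TwoLegSizesMSTQ L M (G.raiseTwoLeg s sl) Q R β U μ K n :=
  twoLegSizesMSFnQ_raiseTwoLeg_of hQ hR h

/-- **`TwoLegCoreTD hist` transfers covariantly at a fixed history.** -/
theorem twoLegCoreTD_raiseTwoLeg_of {hist : TrigPolyC4v → ℕ → Prop} (h : TwoLegCoreTD L M hist G P Q R β U μ K n) :
    TwoLegCoreTD L M hist (G.raiseTwoLeg s sl) P Q R β U μ K n :=
  ⟨twoLegSizesT1Fn_raiseTwoLeg_of h.1, frameLipschitzFnTD_raiseTwoLeg_of h.2.1, h.2.2⟩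

/-- **The step's first conjunct transfers**: `TwoLegCoreTD (histV15 … G …) G … → TwoLegCoreTD (histV15 … (G.raiseTwoLeg s sl) …) (G.raiseTwoLeg s sl) …`
(the comparison history is invariant, the conclusion majorants grow). -/
theorem twoLegCoreTD_histV15_raiseTwoLeg_of (h : TwoLegCoreTD L M (histV15 L M G P Q R β U μ) G P Q R β U μ K n) :
    TwoLegCoreTD L M (histV15 L M (G.raiseTwoLeg s sl) P Q R β U μ) (G.raiseTwoLeg s sl) P Q R β U μ K n := by
  rw [histV15_raiseTwoLeg_eq]
  exact twoLegCoreTD_raiseTwoLeg_of h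

/-- **The history transfers**: `HistP klPredsV15 … G …`'s ENGINE, SPLIT and RENORM components are invariant under `raiseTwoLeg`; this lemma
records the engine component by name (`∀ j < n, EngineBoundsAtV10S … (G.raiseTwoLeg s sl) … j ↔ … G … j`). -/
theorem engineHist_raiseTwoLeg_iff (s : ℕ → ℝ) (sl : ℝ) :
    (∀ j < n, EngineBoundsAtV10S L M (G.raiseTwoLeg s sl) P Q β U μ K j) ↔ (∀ j < n, EngineBoundsAtV10S L M G P Q β U μ K j) := Iff.rfl

end Model

end

end Summit.HubbardSuperconductivity.HubbardSuperconductivity.Theorems.KLRegimeSplit
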